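import Summits.Ventures.LatticeQCDFlow.Scoring.UNOnePlaquettePlaquetteRange
import HarnessLib

/-!
# Tilted laws of a bounded observable: the tilted mean is `M⁻¹ (cgf)'` and is STRICTLY increasing off point masses

HONEST FRAMING: exact (Metropolis-corrected) sampling algorithms for lattice gauge theory;
figures of merit are autocorrelation/cost numbers at stated couplings and volumes; no
continuum-physics claim.

Venture `LatticeQCDFlow` (cell pub-lqcd), sub-topic `Scoring`; FANOUT row 5 (`s0-sun-a`), GEN-19.
NEW WORK of the cell (placement rule).  Abstract complement to GEN-17's `OnePlaquetteHaarMGF` §1 (bounded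
observables: `cgf` analytic and convex on `ℝ`) and `UNOnePlaquettePlaquetteRange` §1 (`tilted_ratio_lt_one`,
`neg_one_lt_tilted_ratio`, `tilted_variance_pos`): for a bounded `X` on a finite measure space and the tilted
weights `e^{−β(M−X)}` (the shape of every one-plaquette law `e^{−β(N − Re tr ρ)}`):

* `tilted_ratio_eq_deriv_cgf` — `∫ (X/M) e^{−β(M−X)} / ∫ e^{−β(M−X)} = M⁻¹ (cgf X μ)'(β)` (Mathlib `deriv_cgf`);
* `tilted_variance_eq` — the tilted variance of `X/M` is `M⁻² (cgf X μ)''(β)` (Mathlib `iteratedDeriv_two_cgf`);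
* `hasDerivAt_tilted_ratio` — the tilted mean is differentiable in `β` with derivative `M⁻¹ (cgf X μ)''(β)`;
* **`strictMono_tilted_ratio`** — if `X ≤ M`, `M > 0`, `{X < M}` and every `{M − ε < X}` are non-null, the tilted
  mean is STRICTLY increasing in `β` (used by `InfiniteVolumeIrreducible2D`: the one-plaquette plaquette of every
  non-trivial irreducible representation is strictly increasing in the coupling, hence non-zero off `β = 0`).

No `def`, nothing cited as a fact, 0 sorry.
-/

noncomputable section

open MeasureTheory ProbabilityTheory Function Filter Topology

namespace Summit.Ventures.LatticeQCDFlow.Scoring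

/-! ## §1. Tilted laws of a bounded observable: the tilted mean is `M⁻¹ (cgf)'`, strictly increasing -/

section Tilted

variable {Ω : Type*} [MeasurableSpace Ω] {μ : Measure Ω} [IsFiniteMeasure μ] {X : Ω → ℝ} {C M : ℝ}

/-- The tilted mean of `X/M` under the weight `e^{−β(M−X)}` is `M⁻¹ · (cgf X μ)'(β)`. -/
theorem tilted_ratio_eq_deriv_cgf [NeZero μ] (hX : AEStronglyMeasurable X μ) (hC : ∀ ω, |X ω| ≤ C) (β : ℝ) :
    (∫ ω, X ω / M * Real.exp (-(β * (M - X ω))) ∂μ) / (∫ ω, Real.exp (-(β * (M - X ω))) ∂μ) =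
      1 / M * deriv (cgf X μ) β := by
  have hint := mem_interior_integrableExpSet_of_abs_le_const hX hC β
  rw [deriv_cgf hint, mgf]
  have hsplit : ∀ ω, Real.exp (-(β * (M - X ω))) = Real.exp (-(M * β)) * Real.exp (β * X ω) := by
    intro ω; rw [← Real.exp_add]; congr 1; ring
  simp_rw [hsplit]
  have h1 : ∀ ω, X ω / M * (Real.exp (-(M * β)) * Real.exp (β * X ω)) =
      Real.exp (-(M * β)) / M * (X ω * Real.exp (β * X ω)) := by
    intro ω; ring
  simp_rw [h1]
  rw [integral_const_mul, integral_const_mul]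
  have hZ : 0 < ∫ ω, Real.exp (β * X ω) ∂μ := integral_exp_pos (integrable_exp_mul_of_abs_le_const hX hC β)
  have he : Real.exp (-(M * β)) ≠ 0 := (Real.exp_pos _).ne'
  by_cases hM : M = 0
  · simp [hM]
  · field_simp

/-- The tilted variance of `X/M` under `e^{−β(M−X)}` is `M⁻² · (cgf X μ)''(β)`. -/
theorem tilted_variance_eq [NeZero μ] (hX : AEStronglyMeasurable X μ) (hC : ∀ ω, |X ω| ≤ C) (β : ℝ) :
    (∫ ω, (X ω / M) ^ 2 * Real.exp (-(β * (M - X ω))) ∂μ) / (∫ ω, Real.exp (-(β * (M - X ω))) ∂μ)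
      - ((∫ ω, X ω / M * Real.exp (-(β * (M - X ω))) ∂μ) / (∫ ω, Real.exp (-(β * (M - X ω))) ∂μ)) ^ 2 =
      1 / M ^ 2 * iteratedDeriv 2 (cgf X μ) β := by
  have hint := mem_interior_integrableExpSet_of_abs_le_const hX hC β
  rw [tilted_ratio_eq_deriv_cgf hX hC β, iteratedDeriv_two_cgf hint, mgf]
  have hsplit : ∀ ω, Real.exp (-(β * (M - X ω))) = Real.exp (-(M * β)) * Real.exp (β * X ω) := by
    intro ω; rw [← Real.exp_add]; congr 1; ring
  simp_rw [hsplit]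
  have h1 : ∀ ω, (X ω / M) ^ 2 * (Real.exp (-(M * β)) * Real.exp (β * X ω)) =
      Real.exp (-(M * β)) / M ^ 2 * (X ω ^ 2 * Real.exp (β * X ω)) := by
    intro ω; ring
  simp_rw [h1]
  rw [integral_const_mul, integral_const_mul]
  have hZ : 0 < ∫ ω, Real.exp (β * X ω) ∂μ := integral_exp_pos (integrable_exp_mul_of_abs_le_const hX hC β)
  have he : Real.exp (-(M * β)) ≠ 0 := (Real.exp_pos _).ne'
  by_cases hM : M = 0
  · simp [hM]
  · field_simp

/-- The tilted mean is differentiable in `β`, with derivative `M⁻¹ (cgf X μ)''(β)`. -/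
theorem hasDerivAt_tilted_ratio [NeZero μ] (hX : AEStronglyMeasurable X μ) (hC : ∀ ω, |X ω| ≤ C) (β : ℝ) :
    HasDerivAt (fun β : ℝ =>
      (∫ ω, X ω / M * Real.exp (-(β * (M - X ω))) ∂μ) / (∫ ω, Real.exp (-(β * (M - X ω))) ∂μ))
      (1 / M * iteratedDeriv 2 (cgf X μ) β) β := by
  have hfun : (fun β : ℝ =>
      (∫ ω, X ω / M * Real.exp (-(β * (M - X ω))) ∂μ) / (∫ ω, Real.exp (-(β * (M - X ω))) ∂μ)) =
      fun β => 1 / M * deriv (cgf X μ) β := funext fun β => tilted_ratio_eq_deriv_cgf hX hC β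
  rw [hfun, iteratedDeriv_succ, iteratedDeriv_one]
  have ha := analyticOnNhd_cgf_univ hX hC
  exact ((ha β (Set.mem_univ β)).deriv.differentiableAt.hasDerivAt).const_mul (1 / M)

/-- **THE TILTED MEAN IS STRICTLY INCREASING** whenever the tilted law of `X ≤ M` (`M > 0`) is not a point mass
(`{X < M}` and every `{M − ε < X}` non-null). -/
theorem strictMono_tilted_ratio (hX : AEStronglyMeasurable X μ) (hC : ∀ ω, |X ω| ≤ C) (hM : 0 < M)
    (hle : ∀ ω, X ω ≤ M) (hlt : 0 < μ {ω | X ω < M}) (hgt : ∀ ε : ℝ, 0 < ε → 0 < μ {ω | M - ε < X ω}) :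
    StrictMono fun β : ℝ =>
      (∫ ω, X ω / M * Real.exp (-(β * (M - X ω))) ∂μ) / (∫ ω, Real.exp (-(β * (M - X ω))) ∂μ) := by
  haveI : NeZero μ := ⟨fun h => by rw [h] at hlt; simp at hlt⟩
  refine strictMono_of_deriv_pos fun β => ?_
  rw [(hasDerivAt_tilted_ratio hX hC β).deriv]
  have hvar := tilted_variance_pos hX hC hM hle hlt hgt β
  rw [tilted_variance_eq hX hC β] at hvar
  have h2 : 0 < iteratedDeriv 2 (cgf X μ) β := (mul_pos_iff_of_pos_left (by positivity)).1 hvar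
  positivity

end Tilted

end Summit.Ventures.LatticeQCDFlow.Scoring
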